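import Summits.HodgeConjecture.HodgeConjecture.Theses.HeckePrymWeil
import Summits.HodgeConjecture.HodgeConjecture.Theorems.WeilTenfoldsSqrtMinus11.Negative.EigenvalueSeparation

/-!
# `WeilTenfoldsSqrtMinus11` (stmt-HodgeConjecture-1262) · Negative · the typed Weil plane is the kernel of an integral quadratic

Negative-side / structural knowledge for the crux `HeckePrymWeil.WeilTenfoldsSqrtMinus11`, from the
standing disprover's work file `Cruxes/WeilTenfoldsSqrtMinus11/Disproof.lean` §G
(refuter-cdisprove-stmt-HodgeConjecture-1262-g2-0, cycle 2, 2026-08-16). Unconditional; valid for EVERY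
abelian variety `A` and EVERY endomorphism `φ` (no dimension, no Weil relation).

The crux types the complexified Weil plane as the join of two eigenspaces,
`Eig(T, λ) ⊔ Eig(T, λ̄)`, `T = (𝟙+φ)^*` on `H¹⁰(A(ℂ); ℂ)`, `λ = (1+i√11)¹⁰`. Here:

* `eigenspace_sup_eigenspace_eq_ker` (generic linear algebra): `Eig(f, μ) ⊔ Eig(f, ν) =
  ker (f² - (μ+ν) f + μν)` for `μ ≠ ν` (the kernel lemma for the coprime factors `X - μ`, `X - ν`).
* `weilXY_eleven_ten`, `weilEigenvalue_ten_eq`, `weilEigenvalues_ten_add`, `weilEigenvalues_ten_mul`: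
  `λ = 243200 + 15872·i√11`, `λ + λ̄ = 486400`, `λ λ̄ = 12¹⁰ = 61917364224` (from the landed
  `weilXY` bookkeeping of `Negative/EigenvalueSeparation`).
* `weilPlane_eq_ker_quadratic`: the typed Weil plane of the crux EQUALS
  `ker (T² - 486400·T + 61917364224·1)` — ONE linear condition with INTEGER coefficients in a pull-back.
  Consequences recorded for both sides: the plane is cut out over `ℤ`, hence is conjugation- and
  Galois-stable and equals `W ⊗ ℂ` for the kernel `W` of the same operator on rational cohomology as soon
  as a `ℚ`-form of `complexBetti` is available (the one missing input of the work file's near-miss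
  `withoutRat_iff : WithoutRat ↔ crux`, and of `WeilDescending`'s rationality step); and a refuter's
  witness `c` must satisfy `T²c - 486400·Tc + 12¹⁰·c = 0` — no existential decomposition needed.
-/

noncomputable section

open Complex CategoryTheory
open Literature.AlgebraicGeometry Literature.AlgebraicGeometry.HodgeTheory

namespace Summit.HodgeConjecture.HodgeConjecture.Theorems.WeilTenfoldsSqrtMinus11.Negative

/-! ## Generic: two eigenspaces = kernel of the quadratic -/

/-- **`Eig(f, μ) ⊔ Eig(f, ν) = ker (f² - (μ+ν) f + μν)` for `μ ≠ ν`** (kernel lemma for the coprime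
factors `X - μ`, `X - ν`, proved by the explicit 2×2 inversion). [folklore] -/
theorem eigenspace_sup_eigenspace_eq_ker {M : Type*} [AddCommGroup M] [Module ℂ M]
    (f : Module.End ℂ M) {μ ν : ℂ} (hμν : μ ≠ ν) :
    f.eigenspace μ ⊔ f.eigenspace ν = LinearMap.ker (f * f - (μ + ν) • f + (μ * ν) • 1) := by
  ext c
  rw [Submodule.mem_sup, LinearMap.mem_ker]
  constructor
  · rintro ⟨y, hy, z, hz, rfl⟩
    rw [Module.End.mem_eigenspace_iff] at hy hz
    simp only [LinearMap.add_apply, LinearMap.sub_apply, LinearMap.smul_apply, Module.End.mul_apply,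
      Module.End.one_apply, map_add, hy, hz, map_smul, smul_smul]
    module
  · intro h
    have hd : μ - ν ≠ 0 := sub_ne_zero.2 hμν
    have h' : f (f c) - (μ + ν) • f c + (μ * ν) • c = 0 := by
      simpa [LinearMap.add_apply, LinearMap.sub_apply, Module.End.mul_apply] using h
    have hff : f (f c) = (μ + ν) • f c - (μ * ν) • c := by
      rw [← sub_eq_zero]
      convert h' using 1
      module
    refine ⟨(μ - ν)⁻¹ • (f c - ν • c), ?_, (μ - ν)⁻¹ • (μ • c - f c), ?_, ?_⟩
    · rw [Module.End.mem_eigenspace_iff, map_smul, map_sub, map_smul, hff]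
      module
    · rw [Module.End.mem_eigenspace_iff, map_smul, map_sub, map_smul, hff]
      module
    · rw [← smul_add]
      have : f c - ν • c + (μ • c - f c) = (μ - ν) • c := by module
      rw [this, smul_smul, inv_mul_cancel₀ hd, one_smul]

/-! ## The integers of the crux: `λ = (1+i√11)¹⁰ = 243200 + 15872·i√11`, `λ + λ̄ = 486400`, `λ λ̄ = 12¹⁰` -/

/-- `weilXY 11 10 = (243200, 15872)`. [folklore] -/
theorem weilXY_eleven_ten : weilXY 11 10 = (243200, 15872) := by decide

/-- `(1+i√11)¹⁰ = 243200 + 15872·i√11`. [folklore] -/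
theorem weilEigenvalue_ten_eq :
    (1 + I * ((Real.sqrt (11 : ℝ) : ℝ) : ℂ)) ^ 10 = 243200 + 15872 * (I * ((Real.sqrt (11 : ℝ) : ℝ) : ℂ)) := by
  have h := one_add_pow_eq ((11 : ℕ) : ℤ) (I * ((Real.sqrt ((11 : ℕ) : ℝ) : ℝ) : ℂ)) (I_mul_sqrt_sq 11) 10
  simp only [Nat.cast_ofNat] at h
  rw [weilXY_eleven_ten] at h
  push_cast at h
  simpa using h

/-- `(1-i√11)¹⁰ = 243200 - 15872·i√11`. [folklore] -/
theorem weilEigenvalueBar_ten_eq :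
    (1 - I * ((Real.sqrt (11 : ℝ) : ℝ) : ℂ)) ^ 10 = 243200 - 15872 * (I * ((Real.sqrt (11 : ℝ) : ℝ) : ℂ)) := by
  have h := one_sub_pow_eq ((11 : ℕ) : ℤ) (I * ((Real.sqrt ((11 : ℕ) : ℝ) : ℝ) : ℂ)) (I_mul_sqrt_sq 11) 10
  simp only [Nat.cast_ofNat] at h
  rw [weilXY_eleven_ten] at h
  push_cast at h
  simpa using h

/-- Trace: `(1+i√11)¹⁰ + (1-i√11)¹⁰ = 486400 ∈ ℤ`. [folklore] -/
theorem weilEigenvalues_ten_add :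
    (1 + I * ((Real.sqrt (11 : ℝ) : ℝ) : ℂ)) ^ 10 + (1 - I * ((Real.sqrt (11 : ℝ) : ℝ) : ℂ)) ^ 10 = 486400 := by
  rw [weilEigenvalue_ten_eq, weilEigenvalueBar_ten_eq]; ring

/-- Norm: `(1+i√11)¹⁰ (1-i√11)¹⁰ = 12¹⁰ = 61917364224 ∈ ℤ`. [folklore] -/
theorem weilEigenvalues_ten_mul :
    (1 + I * ((Real.sqrt (11 : ℝ) : ℝ) : ℂ)) ^ 10 * (1 - I * ((Real.sqrt (11 : ℝ) : ℝ) : ℂ)) ^ 10 = 61917364224 := by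
  rw [← mul_pow]
  have h : (1 + I * ((Real.sqrt (11 : ℝ) : ℝ) : ℂ)) * (1 - I * ((Real.sqrt (11 : ℝ) : ℝ) : ℂ)) = 12 := by
    have hsq : (I * ((Real.sqrt (11 : ℝ) : ℝ) : ℂ)) ^ 2 = -11 := by
      have := I_mul_sqrt_sq 11
      push_cast at this
      simpa using this
    linear_combination (exp := 1) (-1 : ℂ) * hsq
  rw [h]; norm_num

/-! ## Crux level -/

/-- **The typed Weil plane of the crux is the kernel of an INTEGRAL quadratic in `(𝟙+φ)^*`**:
`Eig((𝟙+φ)^*, (1+i√11)¹⁰) ⊔ Eig((𝟙+φ)^*, (1-i√11)¹⁰) = ker (T² - 486400·T + 61917364224)`,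
`T = (𝟙+φ)^*` on `H¹⁰(A(ℂ); ℂ)` — for EVERY abelian variety `A` and EVERY `φ` (no dimension, no Weil
relation). Consequences: membership in the plane is ONE linear equation with integer coefficients in a
pull-back (so the plane is Galois/conjugation-stable and is `W ⊗ ℂ` for the ℚ-subspace `W = ker` of the
same operator on rational cohomology as soon as a ℚ-form of `complexBetti` is available — the missing
input of the work file's near-miss `withoutRat_iff`); a refuter's witness must solve `T²c - 486400·Tc +
12¹⁰ c = 0`. [folklore] -/
theorem weilPlane_eq_ker_quadratic (A : Motives.AbelianVariety ℂ) (φ : A ⟶ A) :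
    Module.End.eigenspace (complexBetti.map (CategoryStruct.id A + φ).hom.hom.hom 10).hom
          ((1 + Complex.I * (Real.sqrt (11 : ℝ) : ℂ)) ^ 10) ⊔
        Module.End.eigenspace (complexBetti.map (CategoryStruct.id A + φ).hom.hom.hom 10).hom
          ((1 - Complex.I * (Real.sqrt (11 : ℝ) : ℂ)) ^ 10) =
      LinearMap.ker
        ((complexBetti.map (CategoryStruct.id A + φ).hom.hom.hom 10).hom *
            (complexBetti.map (CategoryStruct.id A + φ).hom.hom.hom 10).hom -
          (486400 : ℂ) • (complexBetti.map (CategoryStruct.id A + φ).hom.hom.hom 10).hom +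
          (61917364224 : ℂ) • 1) := by
  rw [eigenspace_sup_eigenspace_eq_ker _ weil11_plus_ne_minus, weilEigenvalues_ten_add,
    weilEigenvalues_ten_mul]

end Summit.HodgeConjecture.HodgeConjecture.Theorems.WeilTenfoldsSqrtMinus11.Negative

end
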